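import Literature.NumberTheory.GaloisRepresentations.DegreeOnePrimesFixedField
import HarnessLib

/-!
# Degree-one primes of a fixed field with prescribed Frobenius, counted in the Galois group

Topic `Literature/NumberTheory/GaloisRepresentations`. Everything in this file is PROVED
(theorems only); it refines the tree's `DegreeOnePrimesFixedField.lean`
(`DegreeOnePrimes.card_mul_card_absNorm_eq_card_conj_mem`: `#H · #{I ⊆ 𝓞 E : N(I) = p} =
#{g ∈ G : g F g⁻¹ ∈ H}`) from "Frobenius in `H`" to "Frobenius equal to a given `h ∈ H`".

Let `L/ℚ` be a finite Galois extension with group `G` (`[IsGaloisGroup G ℚ L]`), `H ≤ G` a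
**commutative** subgroup (e.g. cyclic, `H = ⟨g⟩`) with fixed field `E` (`[IsGaloisGroup H E L]`),
`p` a prime all of whose primes `Q` in `𝓞 L` have trivial inertia group, `Q₀ ∣ p` with
arithmetic Frobenius `F ∈ G`, and `h ∈ H`.  The main results:

* `card_mul_card_frob_eq_card_conj_eq` — **`#H · #{P' ∣ p in 𝓞 E : f(P'/p) = 1 and every prime
  of 𝓞 L above P' has Frobenius h} = #{x ∈ G : x F x⁻¹ = h}`**, and its `HeightOneSpectrum` /
  `Ideal.absNorm` form `card_mul_card_absNorm_frob_eq_card_conj_eq` (primes of `𝓞 E` of norm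
  `p`, the shape of `Literature.NumberTheory.LFunctions.primeNormCount`);
* `card_conj_eq_of_isConj`, `card_conj_eq_zero_of_not_isConj` — `#{x : x F x⁻¹ = h}` is
  `#C_G(h)` if `h` is conjugate to `F` and `0` otherwise.

Hence the number of degree-one primes of `E` above `p` whose Frobenius in `L/E` is `h` is
`#C_G(h)/#H` if the Frobenius class of `p` in `G` is that of `h`, and `0` otherwise.  This is
the count in Deuring's reduction of Chebotarev's theorem to the cyclic case (Neukirch,
*Algebraic Number Theory*, VII (13.4), proof: "`ρ⁻¹((Ideal.span {(p : ℤ)})) ≅ Z(σ)/(σ)`") and in Chebotarev's own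
proof (Stevenhagen–Lenstra 1996), where `H = ⟨(σ, τ)⟩ ≤ Gal(L(ζ_m)/ℚ)` and `h = (σ, τ)`: it
transfers the density of `{𝔔 ⊂ 𝓞 E : Frob_𝔔 = h}` (a set of primes of `E`, of density
`1/#H` once the cyclic/cyclotomic case is known) to the density `#⟨h⟩/#G` of the rational
primes with Frobenius class `⟨h⟩`.  Proof: along the transitive `G`-action on the primes of
`𝓞 L` above `p` (`DegreeOnePrimes.card_smul_eq_card_stabilizer_mul`, stabilisers of order
`f(Q₀/p)`), `#{x : x F x⁻¹ = h} = f · #{Q ∣ p : Frob(Q) = h}`; such `Q` lie above degree-one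
primes `P'` of `E` (`inertiaDeg_eq_one_of_isArithFrobAt_of_mem`), all primes of `𝓞 L` above the
same `P'` are `H`-conjugate and so have the same Frobenius `h` (`H` commutative), and there are
`#H / f` of them (fundamental identity for `L/E`).

## References

* J. Neukirch, *Algebraic Number Theory*, Grundlehren 322, Springer 1999, Ch. I §9 and Ch. VII
  (13.4), proof. [NeukirchANT1999]
* P. Stevenhagen, H. W. Lenstra, *Chebotarëv and his density theorem*, Math. Intelligencer 18
  (1996), §3. [StevenhagenLenstra1996]
-/

noncomputable section

open NumberField Ideal
open scoped Pointwise

namespace Literature.NumberTheory.GaloisRepresentations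

namespace DegreeOnePrimes

/-! ### Counting solutions of `x F x⁻¹ = h` -/

section Conj

variable {G : Type*} [Group G]

/-- If `F` and `h` are conjugate, `h = x₀ F x₀⁻¹`, then `x ↦ x x₀⁻¹` is a bijection
`{x : x F x⁻¹ = h} ≃ C_G(h)`; in particular `#{x : x F x⁻¹ = h} = #C_G(h)`. [folklore] -/
theorem card_conj_eq_of_isConj {F h : G} (hc : IsConj F h) :
    Nat.card {x : G // x * F * x⁻¹ = h} = Nat.card (Subgroup.centralizer ({h} : Set G)) := by
  obtain ⟨x₀, hx₀⟩ := isConj_iff.mp hc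
  refine Nat.card_congr
    { toFun := fun x ↦ ⟨x.1 * x₀⁻¹, ?_⟩
      invFun := fun y ↦ ⟨y.1 * x₀, ?_⟩
      left_inv := fun x ↦ Subtype.ext (by simp)
      right_inv := fun y ↦ Subtype.ext (by simp) }
  · rw [Subgroup.mem_centralizer_iff]
    intro k hk
    rw [Set.mem_singleton_iff] at hk
    subst hk
    have hx := x.2
    -- `k = x F x⁻¹ = (x x₀⁻¹) k (x x₀⁻¹)⁻¹`
    calc k * (x.1 * x₀⁻¹) = x.1 * F * x.1⁻¹ * (x.1 * x₀⁻¹) := by rw [hx]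
      _ = x.1 * x₀⁻¹ * (x₀ * F * x₀⁻¹) := by group
      _ = x.1 * x₀⁻¹ * k := by rw [hx₀]
  · have hy := Subgroup.mem_centralizer_iff.mp y.2 h (Set.mem_singleton h)
    calc y.1 * x₀ * F * (y.1 * x₀)⁻¹ = y.1 * (x₀ * F * x₀⁻¹) * y.1⁻¹ := by group
      _ = y.1 * h * y.1⁻¹ := by rw [hx₀]
      _ = h * y.1 * y.1⁻¹ := by rw [hy]
      _ = h := by group

/-- If `F` and `h` are not conjugate there is no `x` with `x F x⁻¹ = h`. [folklore] -/
theorem card_conj_eq_zero_of_not_isConj {F h : G} (hc : ¬ IsConj F h) :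
    Nat.card {x : G // x * F * x⁻¹ = h} = 0 := by
  rw [Nat.card_eq_zero]
  left
  exact ⟨fun x ↦ hc (isConj_iff.mpr ⟨x.1, x.2⟩)⟩

end Conj

/-! ### The refined fibrewise count -/

section NumberField

variable {L : Type*} [Field L] [NumberField L] {G : Type*} [Group G]
  [MulSemiringAction G L] [IsGaloisGroup G ℚ L]

variable (p : ℕ) [hp : Fact p.Prime]

variable (E : IntermediateField ℚ L) (H : Subgroup G) [IsGaloisGroup H E L] [Finite G]

variable [IsMulCommutative H]

/-- **Refined fibrewise count.** With `f = f(Q₀/p)` the common residue degree of the primes of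
`𝓞 L` above `p` (all with trivial inertia), `H` commutative and `h ∈ H`:
`f · #{Q ∣ p in 𝓞 L : Frob(Q) = h} = #H · #{P' ∣ p in 𝓞 E : f(P'/p) = 1, Frob(Q) = h for all Q ∣ P'}`
— a prime `Q` with Frobenius `h ∈ H` lies over a degree-one `P'`
(`inertiaDeg_eq_one_of_isArithFrobAt_of_mem`), the primes above the same `P'` are `H`-conjugate
(Mathlib `Ideal.exists_smul_eq_of_isGaloisGroup` for `L/E`) so that all of them have Frobenius
`τ h τ⁻¹ = h`, and there are `#H / f` of them (Mathlib
`Ideal.ncard_primesOver_mul_card_inertia_mul_finrank`).  Compare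
`DegreeOnePrimes.inertiaDeg_mul_card_frob_mem` ("`Frob(Q) ∈ H`").
[cite: NeukirchANT1999, Ch. I §9 Prop. (9.4)–(9.6)] -/
theorem inertiaDeg_mul_card_frob_eq (Q₀ : Ideal (𝓞 L)) [Q₀.IsPrime] [Q₀.LiesOver (Ideal.span {(p : ℤ)})]
    (hunr : ∀ Q : Ideal (𝓞 L), Q.IsPrime → Q.LiesOver (Ideal.span {(p : ℤ)}) → Q.inertia G = ⊥) {h : G} (hh : h ∈ H) :
    Q₀.inertiaDeg ℤ *
        Nat.card {Q : primesOver (Ideal.span {(p : ℤ)}) (𝓞 L) // ∀ σ : G, IsArithFrobAt ℤ σ Q.1 → σ = h} =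
      Nat.card H * Nat.card {P' : primesOver (Ideal.span {(p : ℤ)}) (𝓞 E) // P'.1.inertiaDeg ℤ = 1 ∧
        ∀ Q : Ideal (𝓞 L), Q.IsPrime → Q.LiesOver P'.1 → ∀ σ : G, IsArithFrobAt ℤ σ Q → σ = h} := by
  classical
  haveI := IsGaloisGroup.of_isFractionRing H (𝓞 E) (𝓞 L) E L
  set f := Q₀.inertiaDeg ℤ with hfdef
  have hf : ∀ Q : primesOver (Ideal.span {(p : ℤ)}) (𝓞 L), Q.1.inertiaDeg ℤ = f := fun Q ↦
    inertiaDeg_eq_of_isGaloisGroup (Ideal.span {(p : ℤ)}) Q.1 Q₀ G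
  -- the restriction map `u : Q ↦ Q ∩ 𝓞 E`
  let u : primesOver (Ideal.span {(p : ℤ)}) (𝓞 L) → primesOver (Ideal.span {(p : ℤ)}) (𝓞 E) := fun Q ↦
    ⟨Q.1.under (𝓞 E), inferInstance, inferInstance⟩
  have hu : ∀ (Q : primesOver (Ideal.span {(p : ℤ)}) (𝓞 L)) (P' : primesOver (Ideal.span {(p : ℤ)}) (𝓞 E)),
      u Q = P' ↔ Q.1.LiesOver P'.1 := by
    intro Q P'
    rw [Subtype.ext_iff, liesOver_iff, eq_comm]
  -- size of a fibre of `u` over a degree-one prime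
  have hfib : ∀ P' : primesOver (Ideal.span {(p : ℤ)}) (𝓞 E), P'.1.inertiaDeg ℤ = 1 →
      f * Nat.card {Q : primesOver (Ideal.span {(p : ℤ)}) (𝓞 L) // Q.1.LiesOver P'.1} = Nat.card H := by
    intro P' hP'
    obtain ⟨⟨Q, hQp, hQl⟩⟩ := (inferInstance : Nonempty (primesOver P'.1 (𝓞 L)))
    haveI : Q.LiesOver (Ideal.span {(p : ℤ)}) := LiesOver.trans Q P'.1 (Ideal.span {(p : ℤ)})
    have hIH : Q.inertia H = ⊥ := by
      rw [eq_bot_iff]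
      intro h hh
      have : (h : G) ∈ Q.inertia G := fun x ↦ hh x
      rw [hunr Q hQp inferInstance, Subgroup.mem_bot] at this
      rw [Subgroup.mem_bot]
      exact Subtype.ext this
    have key := ncard_primesOver_mul_card_inertia_mul_finrank (G := H) P'.1 Q
    rw [hIH, Subgroup.card_bot, mul_one, ← Nat.card_coe_set_eq,
      ← Nat.card_congr (primesOverEquiv p E P')] at key
    have hfQ : Q.inertiaDeg (𝓞 E) = f := by
      have t := inertiaDeg_tower (R := ℤ) P'.1 Q
      rw [hP', one_mul] at t
      rw [← t]
      exact hf ⟨Q, hQp, inferInstance⟩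
    rw [hfQ] at key
    rw [mul_comm]
    exact key
  -- the predicate and its behaviour on fibres
  let c : primesOver (Ideal.span {(p : ℤ)}) (𝓞 L) → Prop := fun Q ↦ ∀ σ : G, IsArithFrobAt ℤ σ Q.1 → σ = h
  let c' : primesOver (Ideal.span {(p : ℤ)}) (𝓞 E) → Prop := fun P' ↦ P'.1.inertiaDeg ℤ = 1 ∧
    ∀ Q : Ideal (𝓞 L), Q.IsPrime → Q.LiesOver P'.1 → ∀ σ : G, IsArithFrobAt ℤ σ Q → σ = h
  have hc : ∀ (Q : primesOver (Ideal.span {(p : ℤ)}) (𝓞 L)) (P' : primesOver (Ideal.span {(p : ℤ)}) (𝓞 E)), u Q = P' → (c Q ↔ c' P') := by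
    intro Q P' hQP'
    haveI : Q.1.LiesOver P'.1 := (hu Q P').mp hQP'
    constructor
    · intro hcQ
      -- a Frobenius at `Q` exists and equals `h ∈ H`, so `P'` has degree one
      haveI : Finite (𝓞 L ⧸ Q.1) := by
        refine Ring.HasFiniteQuotients.finiteQuotient ?_
        refine ne_bot_of_liesOver_of_ne_bot (p := (Ideal.span {(p : ℤ)})) ?_ Q.1
        simp [hp.out.ne_zero]
      obtain ⟨σ₀, hσ₀⟩ := IsArithFrobAt.exists_of_isInvariant ℤ G Q.1
      have hσ₀h : σ₀ = h := hcQ σ₀ hσ₀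
      have hdeg : P'.1.inertiaDeg ℤ = 1 :=
        inertiaDeg_eq_one_of_isArithFrobAt_of_mem p E H P'.1 Q.1 hσ₀ (hσ₀h ▸ hh)
      refine ⟨hdeg, fun Q' hQ' hQ'P' σ hσ ↦ ?_⟩
      -- `Q' = τ • Q` for some `τ ∈ H`, and `τ⁻¹ σ τ` is a Frobenius at `Q`
      haveI := hQ'
      haveI := hQ'P'
      obtain ⟨τ, hτ⟩ := Ideal.exists_smul_eq_of_isGaloisGroup P'.1 Q.1 Q' H
      have hστ : IsArithFrobAt ℤ ((τ : G)⁻¹ * σ * (τ : G)⁻¹⁻¹) ((τ : G)⁻¹ • Q') := hσ.conj (τ : G)⁻¹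
      have hQ'eq : (τ : G)⁻¹ • Q' = Q.1 := by
        rw [← hτ]
        change (τ : G)⁻¹ • ((τ : G) • Q.1) = Q.1
        rw [inv_smul_smul]
      rw [hQ'eq, inv_inv] at hστ
      have h1 : (τ : G)⁻¹ * σ * (τ : G) = h := hcQ _ hστ
      -- commutativity of `H`
      have hcomm : (τ : G) * h = h * (τ : G) := by
        have := IsMulCommutative.is_comm.comm (⟨(τ : G), τ.2⟩ : H) ⟨h, hh⟩
        exact congrArg Subtype.val this
      calc σ = (τ : G) * ((τ : G)⁻¹ * σ * (τ : G)) * (τ : G)⁻¹ := by group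
        _ = (τ : G) * h * (τ : G)⁻¹ := by rw [h1]
        _ = h * (τ : G) * (τ : G)⁻¹ := by rw [hcomm]
        _ = h := by group
    · rintro ⟨-, hall⟩
      exact hall Q.1 Q.2.1 ((hu Q P').mp hQP')
  -- fibrewise count
  letI := Fintype.ofFinite H
  rw [Nat.card_eq_fintype_card (α := {Q : primesOver (Ideal.span {(p : ℤ)}) (𝓞 L) // c Q}), Fintype.card_subtype,
    Finset.card_eq_sum_card_fiberwise (f := u) (t := (Finset.univ : Finset (primesOver (Ideal.span {(p : ℤ)}) (𝓞 E))))
      (fun _ _ ↦ Finset.mem_coe.mpr (Finset.mem_univ _)),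
    Finset.mul_sum, Nat.card_eq_fintype_card (α := {P' : primesOver (Ideal.span {(p : ℤ)}) (𝓞 E) // c' P'}),
    Fintype.card_subtype, Finset.card_eq_sum_ones, Finset.mul_sum, Finset.sum_filter]
  refine Finset.sum_congr rfl fun P' _ ↦ ?_
  by_cases hP' : c' P'
  · rw [if_pos hP', mul_one, ← hfib P' hP'.1, Finset.filter_filter]
    congr 1
    rw [Nat.card_eq_fintype_card, Fintype.card_subtype]
    refine congrArg Finset.card (Finset.filter_congr fun Q _ ↦ ?_)
    rw [← hu Q P']
    exact ⟨fun hQ ↦ hQ.2, fun hQ ↦ ⟨(hc Q P' hQ).mpr hP', hQ⟩⟩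
  · rw [if_neg hP', Finset.filter_filter]
    have : (Finset.univ.filter fun Q : primesOver (Ideal.span {(p : ℤ)}) (𝓞 L) ↦ c Q ∧ u Q = P') = ∅ :=
      Finset.filter_eq_empty_iff.mpr fun Q _ hQ ↦ hP' ((hc Q P' hQ.2).mp hQ.1)
    rw [this, Finset.card_empty, mul_zero]

/-- **Degree-one primes of the fixed field with prescribed Frobenius, counted in `G`.** Let
`L/ℚ` be Galois with finite group `G`, `H ≤ G` commutative with fixed field `E`, `p` a prime
such that every prime of `𝓞 L` above `p` has trivial inertia group, `Q₀ ∣ p` with arithmetic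
Frobenius `F`, and `h ∈ H`.  Then
`#H · #{P' ∣ p in 𝓞 E : f(P'/p) = 1 and every Q ∣ P' in 𝓞 L has Frobenius h} = #{x ∈ G : x F x⁻¹ = h}`
(`= #C_G(h)` or `0` according as `h` is conjugate to `F` or not, `card_conj_eq_of_isConj`).
This is the count `ρ⁻¹((Ideal.span {(p : ℤ)})) ≅ Z(σ)/(σ)` of Neukirch's proof of (13.4) (there `H = ⟨σ⟩`).
[cite: NeukirchANT1999, VII Thm. (13.4) (proof)] -/
theorem card_mul_card_frob_eq_card_conj_eq (Q₀ : Ideal (𝓞 L)) [Q₀.IsPrime] [Q₀.LiesOver (Ideal.span {(p : ℤ)})]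
    (hunr : ∀ Q : Ideal (𝓞 L), Q.IsPrime → Q.LiesOver (Ideal.span {(p : ℤ)}) → Q.inertia G = ⊥)
    {F : G} (hF : IsArithFrobAt ℤ F Q₀) {h : G} (hh : h ∈ H) :
    Nat.card H * Nat.card {P' : primesOver (Ideal.span {(p : ℤ)}) (𝓞 E) // P'.1.inertiaDeg ℤ = 1 ∧
        ∀ Q : Ideal (𝓞 L), Q.IsPrime → Q.LiesOver P'.1 → ∀ σ : G, IsArithFrobAt ℤ σ Q → σ = h} =
      Nat.card {x : G // x * F * x⁻¹ = h} := by
  classical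
  let P₀ : primesOver (Ideal.span {(p : ℤ)}) (𝓞 L) := ⟨Q₀, ‹_›, ‹_›⟩
  let c : primesOver (Ideal.span {(p : ℤ)}) (𝓞 L) → Prop := fun Q ↦ ∀ σ : G, IsArithFrobAt ℤ σ Q.1 → σ = h
  -- Step 1: `x F x⁻¹` is *the* Frobenius of `x • Q₀`
  have h1 : Nat.card {x : G // x * F * x⁻¹ = h} = Nat.card {x : G // c (x • P₀)} := by
    refine Nat.card_congr (Equiv.subtypeEquivRight fun x ↦ ?_)
    have hFx : IsArithFrobAt ℤ (x * F * x⁻¹) (x • P₀).1 := hF.conj x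
    constructor
    · intro hx σ hσ
      rw [isArithFrobAt_unique hσ hFx (hunr _ (x • P₀).2.1 (x • P₀).2.2), hx]
    · intro hcx
      exact hcx _ hFx
  -- Step 2: count along the transitive action of `G` on the primes above `p`
  have h2 := card_smul_eq_card_stabilizer_mul (G := G) c P₀
  -- Step 3: the stabilizer (decomposition group) of `Q₀` has order `f = f(Q₀/p)`
  have h3 : Nat.card (MulAction.stabilizer G P₀) = Q₀.inertiaDeg ℤ := by
    have e : MulAction.stabilizer G P₀ = MulAction.stabilizer G Q₀ := by
      ext x
      simp only [MulAction.mem_stabilizer_iff, Subtype.ext_iff, coe_smul_primesOver, P₀]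
    rw [e, card_stabilizer_eq_card_inertia_mul_finrank (Ideal.span {(p : ℤ)}) Q₀, hunr Q₀ ‹_› ‹_›, Subgroup.card_bot,
      one_mul]
  -- Step 4: the refined fibrewise count
  have h4 := inertiaDeg_mul_card_frob_eq p E H Q₀ hunr hh
  rw [h1, h2, h3, ← h4]

omit [IsGaloisGroup G ℚ L] [IsGaloisGroup H E L] [Finite G] [IsMulCommutative H] in
/-- An ideal of `𝓞 E` has norm `p` iff it is a prime above `p` of residue degree one
(`N(P') = p^{f(P'/p)}`, Mathlib `Ideal.absNorm_eq_pow_inertiaDeg'`; cf.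
`DegreeOnePrimes.card_absNorm_eq_card_inertiaDeg_eq_one`). [folklore] -/
theorem absNorm_eq_iff_liesOver_and_inertiaDeg_eq_one (I : Ideal (𝓞 E)) :
    absNorm I = p ↔ ∃ (_ : I.IsPrime) (_ : I.LiesOver (Ideal.span {(p : ℤ)})), I.inertiaDeg ℤ = 1 := by
  have hpow : ∀ P' : Ideal (𝓞 E), P'.IsPrime → P'.LiesOver (Ideal.span {(p : ℤ)}) →
      absNorm P' = p ^ P'.inertiaDeg ℤ := by
    intro P' _ _
    haveI : P'.IsMaximal := IsMaximal.of_liesOver_isMaximal P' (Ideal.span {(p : ℤ)})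
    rw [absNorm_eq_pow_inertiaDeg' P' hp.out, inertiaDeg'_eq_inertiaDeg]
  constructor
  · intro hI
    haveI hprime : I.IsPrime := isPrime_of_irreducible_absNorm (hI ▸ hp.out)
    haveI hover : I.LiesOver (Ideal.span {(p : ℤ)}) := by
      refine (liesOver_span_iff hprime.ne_top (Nat.prime_iff_prime_int.mp hp.out)).mpr ?_
      have := absNorm_mem I
      rwa [hI, ← map_natCast (algebraMap ℤ (𝓞 E))] at this
    refine ⟨hprime, hover, ?_⟩
    have h := hpow I hprime hover
    rw [hI] at h
    have h1 : p ^ 1 = p ^ I.inertiaDeg ℤ := by rwa [pow_one]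
    exact (Nat.pow_right_injective hp.out.two_le h1).symm
  · rintro ⟨hprime, hover, hf⟩
    rw [hpow I hprime hover, hf, pow_one]

/-- **The same count for the nonzero primes of `𝓞 E` of norm `p`** (the shape of
`Literature.NumberTheory.LFunctions.primeNormCount`, through which densities of sets of primes of `E` are
compared with densities of sets of rational primes):
`#H · #{v : N(v) = p and every Q ∣ v in 𝓞 L has Frobenius h} = #{x ∈ G : x F x⁻¹ = h}`.
[cite: NeukirchANT1999, VII Thm. (13.4) (proof)] -/
theorem card_mul_card_absNorm_frob_eq_card_conj_eq (Q₀ : Ideal (𝓞 L)) [Q₀.IsPrime]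
    [Q₀.LiesOver (Ideal.span {(p : ℤ)})] (hunr : ∀ Q : Ideal (𝓞 L), Q.IsPrime → Q.LiesOver (Ideal.span {(p : ℤ)}) → Q.inertia G = ⊥)
    {F : G} (hF : IsArithFrobAt ℤ F Q₀) {h : G} (hh : h ∈ H) :
    Nat.card H * Nat.card {v : IsDedekindDomain.HeightOneSpectrum (𝓞 E) //
        absNorm v.asIdeal = p ∧ ∀ Q : Ideal (𝓞 L), Q.IsPrime → Q.LiesOver v.asIdeal →
          ∀ σ : G, IsArithFrobAt ℤ σ Q → σ = h} =
      Nat.card {x : G // x * F * x⁻¹ = h} := by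
  rw [← card_mul_card_frob_eq_card_conj_eq p E H Q₀ hunr hF hh]
  congr 1
  refine Nat.card_congr
    { toFun := fun v ↦ ⟨⟨v.1.asIdeal, ((absNorm_eq_iff_liesOver_and_inertiaDeg_eq_one p E
          v.1.asIdeal).mp v.2.1).fst, ((absNorm_eq_iff_liesOver_and_inertiaDeg_eq_one p E
          v.1.asIdeal).mp v.2.1).snd.fst⟩,
        ((absNorm_eq_iff_liesOver_and_inertiaDeg_eq_one p E v.1.asIdeal).mp v.2.1).snd.snd,
        v.2.2⟩
      invFun := fun P' ↦ ⟨⟨P'.1.1, P'.1.2.1, ?_⟩, ?_, P'.2.2⟩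
      left_inv := fun v ↦ rfl
      right_inv := fun P' ↦ rfl }
  · -- nonzero: its norm is `p ≠ 0`
    intro h0
    have hN : absNorm P'.1.1 = p :=
      (absNorm_eq_iff_liesOver_and_inertiaDeg_eq_one p E P'.1.1).mpr ⟨P'.1.2.1, P'.1.2.2, P'.2.1⟩
    rw [h0, absNorm_bot] at hN
    exact hp.out.ne_zero hN.symm
  · exact (absNorm_eq_iff_liesOver_and_inertiaDeg_eq_one p E P'.1.1).mpr
      ⟨P'.1.2.1, P'.1.2.2, P'.2.1⟩

end NumberField

end DegreeOnePrimes

end Literature.NumberTheory.GaloisRepresentations
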